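import Summits.BirchSwinnertonDyer.Rank1Residual.Additive.KatoDescentKatoRigidCharacterDictionary
import Literature.NumberTheory.EllipticCurves.CyclotomicZpExtensionLayerTorsionProofs
import HarnessLib

set_option autoImplicit false

/-!
# AUG engine, step 14: the REPRESENTATION CALCULUS in `ℚ_p ⊗_ℚ ℂ` — complex numbers read as values `R(u − 1)` of
# polynomial representatives `R ≡ Φ (mod ω_n)` of Iwasawa functions `Φ ∈ ℤ_p⟦T⟧`; closure under ring operations, rational
# constants of `p`-adic norm `≤ 1`, and the atoms `χ̄(χ_cyc σ) ↔ (1 + T)^{κ(σ)}`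
# (seat `bsd-cm-prr-ty1` g15, cell `bsd-cm`; theorems only: no definition, no named fact, no instance, no `sorry`)

Part 56 of the seat's kernel cut of stub 3 of the Kato–Perrin-Riou skeletons v4 (cruxes stmt-BirchSwinnertonDyer-19945 /
-19223).  ENDGAME step (R2) of HOME `bsd-cm-prr-ty1/STUB3-CUT.md` §6 addendum 8: the explicit numbers of (★χ)
(E35 `aeval_mul_explicitValues_eq_of_augData`: `q·P(χ,1)·𝒸⁻_χ̄(π)`, rational combinations of values of `χ̄`) must be written
as `R(u − 1)`, `u = 1 ⊗ χ̄(χ_cyc γ)`, for polynomial representatives `R ∈ ℤ_p[X]` of LEVEL-INDEPENDENT Iwasawa functions.  The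
dictionary E38 `one_tmul_inv_apply_cyc_eq_aeval` does this for the atoms `χ̄(χ_cyc σ) ↔ (1 + T)^{κ(σ)}`.  THIS FILE is the calculus
around it, for the relation «`X ∈ ℂ` is READ BY `Φ ∈ ℤ_p⟦T⟧` at `(n, u)`» := `∀ R, Φ − R ∈ (ω_n) → 1 ⊗ X = R(u − 1)` (kept
inline, no definition), valid when `u^{p^n} = 1` (E34 `aeval_eq_aeval_of_sub_mem_span`: the value is representative-free):
* §1 representatives: existence (tree `IwasawaH1Exists.exists_polynomial_sub_coe_mem_span`), products / sums / differences of
  representatives are representatives;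
* §2 closure: `read_one`, `read_const` (a rational `r` lying in `ℤ_p`, `r = y`, is read by the constant `C y`), `read_mul`, `read_add`,
  `read_sub`, `read_prod` (finite products);
* §3 atoms: `read_inv_apply` (`χ̄(χ_cyc σ)` by `(1 + T)^{κ(σ)}`, E38), `read_apply` (`χ(χ_cyc σ)` by `(1 + T)^{κ(σ⁻¹)}`);
  `exists_forall_modNCyclotomicCharacter_eq_intCast` (an integer `m` prime to `p` is `χ_cyc^{(p^j)}(σ_m)` at EVERY level `j`, by the
  surjectivity of the `p`-adic cyclotomic character, tree `GaloisRep.cyclotomicCharacter_rat_surjective`) — so `χ̄(m)`, `χ(m)` are read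
  by level-independent group-like elements;
* §4 `exists_norm_pow_mul_ratCast_le_one` (`p`-power clearing of a rational), `norm_ratCast_inv_natCast_eq_one` (`1/ℓ ∈ ℤ_pˣ`, `ℓ ≠ p`).
HONEST LABEL: Iwasawa-algebra bookkeeping serving the seat's AUG engine; no stub closed; nothing asserted on 19945 / 19223; no
summit statement is proved; BSD is not proved for any curve.
References: [Washington1997] §7.1–§7.2 (Λ ≅ ℤ_p⟦T⟧, `γ ↦ 1 + T`, Prop. 7.2), §13.1; [Kato2004Asterisque] §13.8–§13.9 (pp. 228–230);
[SerreAbelianLadic1968] Ch. I §1.2 (the cyclotomic character).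
-/

noncomputable section

open scoped BigOperators TensorProduct
open Polynomial Field
open Literature.NumberTheory.GaloisRepresentations
open Literature.NumberTheory.EllipticCurves Literature.NumberTheory.EllipticCurves.Kato2004

namespace Summit.BirchSwinnertonDyer.Rank1Residual.Additive.PerrinRiouUnit

variable {p : ℕ} [hp : Fact p.Prime]

/-! ## §1 Representatives modulo `ω_n` -/

section Reps

variable (n : ℕ)

/-- Every `Φ ∈ ℤ_p⟦T⟧` has a polynomial representative modulo `ω_n` (Weierstrass division; the tree's
`IwasawaH1Exists.exists_polynomial_sub_coe_mem_span`). [cite: Washington1997, Prop. 7.2] -/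
theorem exists_rep (Φ : PowerSeries ℤ_[p]) :
    ∃ R : ℤ_[p][X], Φ - (R : PowerSeries ℤ_[p]) ∈
      Ideal.span {(((X + 1 : ℤ_[p][X]) ^ p ^ n - 1 : ℤ_[p][X]) : PowerSeries ℤ_[p])} :=
  IwasawaH1Exists.exists_polynomial_sub_coe_mem_span p n Φ

/-- The product of representatives represents the product. [folklore] -/
theorem rep_mul {Φ Ψ : PowerSeries ℤ_[p]} {R S : ℤ_[p][X]}
    (hR : Φ - (R : PowerSeries ℤ_[p]) ∈ Ideal.span {(((X + 1 : ℤ_[p][X]) ^ p ^ n - 1 : ℤ_[p][X]) : PowerSeries ℤ_[p])})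
    (hS : Ψ - (S : PowerSeries ℤ_[p]) ∈ Ideal.span {(((X + 1 : ℤ_[p][X]) ^ p ^ n - 1 : ℤ_[p][X]) : PowerSeries ℤ_[p])}) :
    Φ * Ψ - ((R * S : ℤ_[p][X]) : PowerSeries ℤ_[p]) ∈
      Ideal.span {(((X + 1 : ℤ_[p][X]) ^ p ^ n - 1 : ℤ_[p][X]) : PowerSeries ℤ_[p])} := by
  have h : Φ * Ψ - ((R * S : ℤ_[p][X]) : PowerSeries ℤ_[p]) =
      Φ * (Ψ - (S : PowerSeries ℤ_[p])) + (Φ - (R : PowerSeries ℤ_[p])) * (S : PowerSeries ℤ_[p]) := by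
    rw [Polynomial.coe_mul]; ring
  rw [h]
  exact Ideal.add_mem _ (Ideal.mul_mem_left _ _ hS) (Ideal.mul_mem_right _ _ hR)

/-- The sum of representatives represents the sum. [folklore] -/
theorem rep_add {Φ Ψ : PowerSeries ℤ_[p]} {R S : ℤ_[p][X]}
    (hR : Φ - (R : PowerSeries ℤ_[p]) ∈ Ideal.span {(((X + 1 : ℤ_[p][X]) ^ p ^ n - 1 : ℤ_[p][X]) : PowerSeries ℤ_[p])})
    (hS : Ψ - (S : PowerSeries ℤ_[p]) ∈ Ideal.span {(((X + 1 : ℤ_[p][X]) ^ p ^ n - 1 : ℤ_[p][X]) : PowerSeries ℤ_[p])}) :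
    Φ + Ψ - ((R + S : ℤ_[p][X]) : PowerSeries ℤ_[p]) ∈
      Ideal.span {(((X + 1 : ℤ_[p][X]) ^ p ^ n - 1 : ℤ_[p][X]) : PowerSeries ℤ_[p])} := by
  have h : Φ + Ψ - ((R + S : ℤ_[p][X]) : PowerSeries ℤ_[p]) =
      (Φ - (R : PowerSeries ℤ_[p])) + (Ψ - (S : PowerSeries ℤ_[p])) := by
    rw [Polynomial.coe_add]; ring
  rw [h]
  exact Ideal.add_mem _ hR hS

/-- The difference of representatives represents the difference. [folklore] -/
theorem rep_sub {Φ Ψ : PowerSeries ℤ_[p]} {R S : ℤ_[p][X]}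
    (hR : Φ - (R : PowerSeries ℤ_[p]) ∈ Ideal.span {(((X + 1 : ℤ_[p][X]) ^ p ^ n - 1 : ℤ_[p][X]) : PowerSeries ℤ_[p])})
    (hS : Ψ - (S : PowerSeries ℤ_[p]) ∈ Ideal.span {(((X + 1 : ℤ_[p][X]) ^ p ^ n - 1 : ℤ_[p][X]) : PowerSeries ℤ_[p])}) :
    Φ - Ψ - ((R - S : ℤ_[p][X]) : PowerSeries ℤ_[p]) ∈
      Ideal.span {(((X + 1 : ℤ_[p][X]) ^ p ^ n - 1 : ℤ_[p][X]) : PowerSeries ℤ_[p])} := by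
  have h : Φ - Ψ - ((R - S : ℤ_[p][X]) : PowerSeries ℤ_[p]) =
      (Φ - (R : PowerSeries ℤ_[p])) - (Ψ - (S : PowerSeries ℤ_[p])) := by
    rw [Polynomial.coe_sub]; ring
  rw [h]
  exact Ideal.sub_mem _ hR hS

/-- A constant represents itself. [folklore] -/
theorem rep_C (y : ℤ_[p]) :
    PowerSeries.C y - ((Polynomial.C y : ℤ_[p][X]) : PowerSeries ℤ_[p]) ∈
      Ideal.span {(((X + 1 : ℤ_[p][X]) ^ p ^ n - 1 : ℤ_[p][X]) : PowerSeries ℤ_[p])} := by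
  rw [Polynomial.coe_C, sub_self]
  exact Ideal.zero_mem _

end Reps

/-! ## §2 The reading relation and its closure properties -/

section Read

variable {n : ℕ} {u : ℚ_[p] ⊗[ℚ] ℂ} (hu : u ^ p ^ n = 1)
include hu

/-- **Reading is representative-free**: if `1 ⊗ x = R₀(u − 1)` for ONE representative `R₀` of `Φ`, then for all.
[cite: Washington1997, §7.1 and Prop. 7.2] -/
theorem read_of_rep {xa : ℂ} {Φ : PowerSeries ℤ_[p]} {R₀ : ℤ_[p][X]}
    (hR₀ : Φ - (R₀ : PowerSeries ℤ_[p]) ∈ Ideal.span {(((X + 1 : ℤ_[p][X]) ^ p ^ n - 1 : ℤ_[p][X]) : PowerSeries ℤ_[p])})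
    (h : ((1 : ℚ_[p]) ⊗ₜ[ℚ] xa : ℚ_[p] ⊗[ℚ] ℂ) = aeval (u - 1) R₀) :
    ∀ R : ℤ_[p][X], Φ - (R : PowerSeries ℤ_[p]) ∈
        Ideal.span {(((X + 1 : ℤ_[p][X]) ^ p ^ n - 1 : ℤ_[p][X]) : PowerSeries ℤ_[p])} →
      ((1 : ℚ_[p]) ⊗ₜ[ℚ] xa : ℚ_[p] ⊗[ℚ] ℂ) = aeval (u - 1) R := fun R hR => by
  rw [h, aeval_eq_aeval_of_sub_mem_span hu hR₀ hR]

/-- `1` is read by `1`. [folklore] -/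
theorem read_one :
    ∀ R : ℤ_[p][X], (1 : PowerSeries ℤ_[p]) - (R : PowerSeries ℤ_[p]) ∈
        Ideal.span {(((X + 1 : ℤ_[p][X]) ^ p ^ n - 1 : ℤ_[p][X]) : PowerSeries ℤ_[p])} →
      ((1 : ℚ_[p]) ⊗ₜ[ℚ] (1 : ℂ) : ℚ_[p] ⊗[ℚ] ℂ) = aeval (u - 1) R := by
  refine read_of_rep hu (R₀ := 1) (by rw [Polynomial.coe_one, sub_self]; exact Ideal.zero_mem _) ?_
  rw [map_one]
  rfl

/-- **A rational constant `r = y ∈ ℤ_p` is read by the constant `C y`**: `1 ⊗ r = r ⊗ 1 = (C y)(u − 1)`. [folklore] -/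
theorem read_const (r : ℚ) (y : ℤ_[p]) (hy : (y : ℚ_[p]) = (r : ℚ_[p])) :
    ∀ R : ℤ_[p][X], PowerSeries.C y - (R : PowerSeries ℤ_[p]) ∈
        Ideal.span {(((X + 1 : ℤ_[p][X]) ^ p ^ n - 1 : ℤ_[p][X]) : PowerSeries ℤ_[p])} →
      ((1 : ℚ_[p]) ⊗ₜ[ℚ] ((r : ℚ) : ℂ) : ℚ_[p] ⊗[ℚ] ℂ) = aeval (u - 1) R := by
  refine read_of_rep hu (rep_C n _) ?_
  rw [Polynomial.aeval_C, IsScalarTower.algebraMap_apply ℤ_[p] ℚ_[p] (ℚ_[p] ⊗[ℚ] ℂ),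
    Algebra.TensorProduct.algebraMap_apply]
  change ((1 : ℚ_[p]) ⊗ₜ[ℚ] ((r : ℚ) : ℂ) : ℚ_[p] ⊗[ℚ] ℂ) = ((y : ℚ_[p]) ⊗ₜ[ℚ] (1 : ℂ))
  rw [hy, ← Rat.smul_one_eq_cast, ← Rat.smul_one_eq_cast, TensorProduct.tmul_smul, TensorProduct.smul_tmul']

/-- **Products**: if `X` is read by `Φ` and `Y` by `Ψ` then `X·Y` is read by `Φ·Ψ`. [folklore] -/
theorem read_mul {xa xb : ℂ} {Φ Ψ : PowerSeries ℤ_[p]}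
    (hX : ∀ R : ℤ_[p][X], Φ - (R : PowerSeries ℤ_[p]) ∈
        Ideal.span {(((X + 1 : ℤ_[p][X]) ^ p ^ n - 1 : ℤ_[p][X]) : PowerSeries ℤ_[p])} →
      ((1 : ℚ_[p]) ⊗ₜ[ℚ] xa : ℚ_[p] ⊗[ℚ] ℂ) = aeval (u - 1) R)
    (hY : ∀ R : ℤ_[p][X], Ψ - (R : PowerSeries ℤ_[p]) ∈
        Ideal.span {(((X + 1 : ℤ_[p][X]) ^ p ^ n - 1 : ℤ_[p][X]) : PowerSeries ℤ_[p])} →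
      ((1 : ℚ_[p]) ⊗ₜ[ℚ] xb : ℚ_[p] ⊗[ℚ] ℂ) = aeval (u - 1) R) :
    ∀ R : ℤ_[p][X], Φ * Ψ - (R : PowerSeries ℤ_[p]) ∈
        Ideal.span {(((X + 1 : ℤ_[p][X]) ^ p ^ n - 1 : ℤ_[p][X]) : PowerSeries ℤ_[p])} →
      ((1 : ℚ_[p]) ⊗ₜ[ℚ] (xa * xb) : ℚ_[p] ⊗[ℚ] ℂ) = aeval (u - 1) R := by
  obtain ⟨R₁, hR₁⟩ := exists_rep n Φ
  obtain ⟨R₂, hR₂⟩ := exists_rep n Ψ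
  refine read_of_rep hu (rep_mul n hR₁ hR₂) ?_
  rw [map_mul, ← hX R₁ hR₁, ← hY R₂ hR₂, Algebra.TensorProduct.tmul_mul_tmul, one_mul]

/-- **Sums**. [folklore] -/
theorem read_add {xa xb : ℂ} {Φ Ψ : PowerSeries ℤ_[p]}
    (hX : ∀ R : ℤ_[p][X], Φ - (R : PowerSeries ℤ_[p]) ∈
        Ideal.span {(((X + 1 : ℤ_[p][X]) ^ p ^ n - 1 : ℤ_[p][X]) : PowerSeries ℤ_[p])} →
      ((1 : ℚ_[p]) ⊗ₜ[ℚ] xa : ℚ_[p] ⊗[ℚ] ℂ) = aeval (u - 1) R)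
    (hY : ∀ R : ℤ_[p][X], Ψ - (R : PowerSeries ℤ_[p]) ∈
        Ideal.span {(((X + 1 : ℤ_[p][X]) ^ p ^ n - 1 : ℤ_[p][X]) : PowerSeries ℤ_[p])} →
      ((1 : ℚ_[p]) ⊗ₜ[ℚ] xb : ℚ_[p] ⊗[ℚ] ℂ) = aeval (u - 1) R) :
    ∀ R : ℤ_[p][X], Φ + Ψ - (R : PowerSeries ℤ_[p]) ∈
        Ideal.span {(((X + 1 : ℤ_[p][X]) ^ p ^ n - 1 : ℤ_[p][X]) : PowerSeries ℤ_[p])} →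
      ((1 : ℚ_[p]) ⊗ₜ[ℚ] (xa + xb) : ℚ_[p] ⊗[ℚ] ℂ) = aeval (u - 1) R := by
  obtain ⟨R₁, hR₁⟩ := exists_rep n Φ
  obtain ⟨R₂, hR₂⟩ := exists_rep n Ψ
  refine read_of_rep hu (rep_add n hR₁ hR₂) ?_
  rw [map_add, ← hX R₁ hR₁, ← hY R₂ hR₂, TensorProduct.tmul_add]

/-- **Differences**. [folklore] -/
theorem read_sub {xa xb : ℂ} {Φ Ψ : PowerSeries ℤ_[p]}
    (hX : ∀ R : ℤ_[p][X], Φ - (R : PowerSeries ℤ_[p]) ∈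
        Ideal.span {(((X + 1 : ℤ_[p][X]) ^ p ^ n - 1 : ℤ_[p][X]) : PowerSeries ℤ_[p])} →
      ((1 : ℚ_[p]) ⊗ₜ[ℚ] xa : ℚ_[p] ⊗[ℚ] ℂ) = aeval (u - 1) R)
    (hY : ∀ R : ℤ_[p][X], Ψ - (R : PowerSeries ℤ_[p]) ∈
        Ideal.span {(((X + 1 : ℤ_[p][X]) ^ p ^ n - 1 : ℤ_[p][X]) : PowerSeries ℤ_[p])} →
      ((1 : ℚ_[p]) ⊗ₜ[ℚ] xb : ℚ_[p] ⊗[ℚ] ℂ) = aeval (u - 1) R) :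
    ∀ R : ℤ_[p][X], Φ - Ψ - (R : PowerSeries ℤ_[p]) ∈
        Ideal.span {(((X + 1 : ℤ_[p][X]) ^ p ^ n - 1 : ℤ_[p][X]) : PowerSeries ℤ_[p])} →
      ((1 : ℚ_[p]) ⊗ₜ[ℚ] (xa - xb) : ℚ_[p] ⊗[ℚ] ℂ) = aeval (u - 1) R := by
  obtain ⟨R₁, hR₁⟩ := exists_rep n Φ
  obtain ⟨R₂, hR₂⟩ := exists_rep n Ψ
  refine read_of_rep hu (rep_sub n hR₁ hR₂) ?_
  rw [map_sub, ← hX R₁ hR₁, ← hY R₂ hR₂, TensorProduct.tmul_sub]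

/-- **Finite products**: if each `X i`, `i ∈ s`, is read by `Φ i`, then `∏_{i∈s} X i` is read by `∏_{i∈s} Φ i`. [folklore] -/
theorem read_prod {ι : Type*} (s : Finset ι) {xa : ι → ℂ} {Φ : ι → PowerSeries ℤ_[p]}
    (h : ∀ i ∈ s, ∀ R : ℤ_[p][X], Φ i - (R : PowerSeries ℤ_[p]) ∈
        Ideal.span {(((Polynomial.X + 1 : ℤ_[p][X]) ^ p ^ n - 1 : ℤ_[p][X]) : PowerSeries ℤ_[p])} →
      ((1 : ℚ_[p]) ⊗ₜ[ℚ] xa i : ℚ_[p] ⊗[ℚ] ℂ) = aeval (u - 1) R) :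
    ∀ R : ℤ_[p][X], (∏ i ∈ s, Φ i) - (R : PowerSeries ℤ_[p]) ∈
        Ideal.span {(((Polynomial.X + 1 : ℤ_[p][X]) ^ p ^ n - 1 : ℤ_[p][X]) : PowerSeries ℤ_[p])} →
      ((1 : ℚ_[p]) ⊗ₜ[ℚ] (∏ i ∈ s, xa i) : ℚ_[p] ⊗[ℚ] ℂ) = aeval (u - 1) R := by
  classical
  induction s using Finset.induction_on with
  | empty =>
    rw [Finset.prod_empty, Finset.prod_empty]
    exact read_one hu
  | insert i s hi ih =>
    rw [Finset.prod_insert hi, Finset.prod_insert hi]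
    exact read_mul hu (h i (Finset.mem_insert_self i s)) (ih fun j hj => h j (Finset.mem_insert_of_mem hj))

end Read

/-! ## §3 Atoms: values of `χ̄` and `χ` at cyclotomic characters; integers prime to `p` as cyclotomic characters -/

section Atoms

variable {K : ZpExtension ℚ p} {γ : absoluteGaloisGroup ℚ} {m : ℕ} [NeZero m]

/-- ★ **`χ̄(χ_cyc σ)` is read by `(1 + T)^{κ(σ)}`** (E38 `one_tmul_inv_apply_cyc_eq_aeval`, restated in the reading shape with the
atom `x = χ_cyc σ`). [cite: Washington1997, §7.1 and §13.1] [cite: Kato2004Asterisque, §13.8 (p. 228)] -/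
theorem read_inv_apply (hγ : K.IsTopGenerator γ) (n : ℕ) (χ : DirichletCharacter ℂ m)
    (hχ : ∀ τ ∈ K.layerSubgroup n, χ ((modNCyclotomicCharacter ℚ m τ : (ZMod m)ˣ) : ZMod m) = 1)
    (σ : absoluteGaloisGroup ℚ) {x : ZMod m} (hx : ((modNCyclotomicCharacter ℚ m σ : (ZMod m)ˣ) : ZMod m) = x) :
    ∀ R : ℤ_[p][X], PowerSeries.binomialSeries ℤ_[p] (K σ).toAdd - (R : PowerSeries ℤ_[p]) ∈
        Ideal.span {(((X + 1 : ℤ_[p][X]) ^ p ^ n - 1 : ℤ_[p][X]) : PowerSeries ℤ_[p])} →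
      ((1 : ℚ_[p]) ⊗ₜ[ℚ] χ⁻¹ x : ℚ_[p] ⊗[ℚ] ℂ) =
        aeval (((1 : ℚ_[p]) ⊗ₜ[ℚ] χ⁻¹ ((modNCyclotomicCharacter ℚ m γ : (ZMod m)ˣ) : ZMod m) : ℚ_[p] ⊗[ℚ] ℂ) - 1) R :=
  fun R hR => by rw [← hx]; exact one_tmul_inv_apply_cyc_eq_aeval hγ n χ hχ σ hR

/-- ★ **`χ(χ_cyc σ)` is read by `(1 + T)^{κ(σ⁻¹)}`** (`χ(b) = χ̄(b⁻¹)` and `χ_cyc(σ⁻¹) = χ_cyc(σ)⁻¹`).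
[cite: Washington1997, §7.1 and §13.1] -/
theorem read_apply (hγ : K.IsTopGenerator γ) (n : ℕ) (χ : DirichletCharacter ℂ m)
    (hχ : ∀ τ ∈ K.layerSubgroup n, χ ((modNCyclotomicCharacter ℚ m τ : (ZMod m)ˣ) : ZMod m) = 1)
    (σ : absoluteGaloisGroup ℚ) {x : ZMod m} (hx : ((modNCyclotomicCharacter ℚ m σ : (ZMod m)ˣ) : ZMod m) = x) :
    ∀ R : ℤ_[p][X], PowerSeries.binomialSeries ℤ_[p] (K σ⁻¹).toAdd - (R : PowerSeries ℤ_[p]) ∈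
        Ideal.span {(((X + 1 : ℤ_[p][X]) ^ p ^ n - 1 : ℤ_[p][X]) : PowerSeries ℤ_[p])} →
      ((1 : ℚ_[p]) ⊗ₜ[ℚ] χ x : ℚ_[p] ⊗[ℚ] ℂ) =
        aeval (((1 : ℚ_[p]) ⊗ₜ[ℚ] χ⁻¹ ((modNCyclotomicCharacter ℚ m γ : (ZMod m)ˣ) : ZMod m) : ℚ_[p] ⊗[ℚ] ℂ) - 1) R := by
  have h1 : χ (((modNCyclotomicCharacter ℚ m σ)⁻¹ : (ZMod m)ˣ) : ZMod m) =
      (χ ((modNCyclotomicCharacter ℚ m σ : (ZMod m)ˣ) : ZMod m))⁻¹ := by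
    rw [← MulChar.coe_toUnitHom, ← MulChar.coe_toUnitHom, map_inv, Units.val_inv_eq_inv_val]
  have hx' : χ x = χ⁻¹ ((modNCyclotomicCharacter ℚ m σ⁻¹ : (ZMod m)ˣ) : ZMod m) := by
    rw [← hx, map_inv, MulChar.inv_apply_eq_inv', h1, inv_inv]
  rw [hx']
  exact read_inv_apply hγ n χ hχ σ⁻¹ rfl

/-- **An integer `m₀` prime to `p` is the cyclotomic character of ONE `σ ∈ Gal(ℚ̄/ℚ)` at every level `p^j`** (the `p`-adic
cyclotomic character is onto `ℤ_pˣ ∋ m₀`). [cite: SerreAbelianLadic1968, Ch. I §1.2] -/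
theorem exists_forall_modNCyclotomicCharacter_eq_intCast {m₀ : ℤ} (hm₀ : IsCoprime m₀ p) :
    ∃ σ : absoluteGaloisGroup ℚ, ∀ (j : ℕ) [NeZero (p ^ j)],
      ((modNCyclotomicCharacter ℚ (p ^ j) σ : (ZMod (p ^ j))ˣ) : ZMod (p ^ j)) = (m₀ : ZMod (p ^ j)) := by
  -- `m₀ ∈ ℤ_pˣ`
  have hunit : IsUnit ((m₀ : ℤ_[p])) := by
    rw [PadicInt.isUnit_iff]
    refine le_antisymm (PadicInt.norm_le_one _) (not_lt.mp fun hlt => ?_)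
    rw [PadicInt.norm_int_lt_one_iff_dvd] at hlt
    have h1 : (p : ℤ) ∣ 1 := hm₀.symm.dvd_of_dvd_mul_left (by rw [mul_one]; exact hlt)
    have h2 : p ∣ 1 := by exact_mod_cast h1
    exact hp.out.one_lt.ne' (Nat.dvd_one.mp h2)
  obtain ⟨σ, hσ⟩ := GaloisRep.cyclotomicCharacter_rat_surjective p hunit.unit
  refine ⟨σ, fun j _ => ?_⟩
  rw [CyclotomicZp.modNCyclotomicCharacter_eq_toZModPow p j σ, hσ, IsUnit.unit_spec, map_intCast]

end Atoms

/-! ## §4 `p`-adic units and `p`-power clearing of rational constants -/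

/-- **`p`-power clearing**: for every rational `r` some `p^v · r` has `p`-adic norm `≤ 1`. [folklore] -/
theorem exists_norm_pow_mul_ratCast_le_one (r : ℚ) : ∃ v : ℕ, ‖(((p : ℚ) ^ v * r : ℚ) : ℚ_[p])‖ ≤ 1 := by
  obtain ⟨v, hv⟩ := exists_nat_gt ‖(r : ℚ_[p])‖
  refine ⟨v, ?_⟩
  have hp1 : (1 : ℝ) < p := by exact_mod_cast hp.out.one_lt
  have hpv : (v : ℝ) < (p : ℝ) ^ v := by exact_mod_cast Nat.lt_pow_self hp.out.one_lt
  have hp0 : (0 : ℝ) < (p : ℝ) ^ v := pow_pos (by linarith) v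
  push_cast
  rw [norm_mul, norm_pow, Padic.norm_p, inv_pow, inv_mul_le_iff₀ hp0, mul_one]
  linarith

/-- **`1/ℓ ∈ ℤ_p` for a prime `ℓ ≠ p`** (indeed a unit): `‖ℓ⁻¹‖_p ≤ 1`. [folklore] -/
theorem norm_ratCast_inv_natCast_le_one {ℓ : ℕ} (hℓ : ℓ.Prime) (hℓp : ℓ ≠ p) : ‖(((ℓ : ℚ)⁻¹ : ℚ) : ℚ_[p])‖ ≤ 1 := by
  have hnd : ¬ (p : ℤ) ∣ (ℓ : ℤ) := by
    intro h
    have h' : p ∣ ℓ := by exact_mod_cast h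
    exact hℓp ((Nat.prime_dvd_prime_iff_eq hp.out hℓ).mp h').symm
  have h1 : ‖((ℓ : ℤ) : ℚ_[p])‖ = 1 :=
    le_antisymm (Padic.norm_int_le_one _) (not_lt.mp fun h => hnd (Padic.norm_intCast_lt_one_iff.mp h))
  push_cast at h1 ⊢
  rw [norm_inv, h1, inv_one]

/-- An integer has `p`-adic norm `≤ 1`. [folklore] -/
theorem norm_ratCast_intCast_le_one (m₀ : ℤ) : ‖((m₀ : ℚ) : ℚ_[p])‖ ≤ 1 := by
  push_cast
  exact Padic.norm_int_le_one m₀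

end Summit.BirchSwinnertonDyer.Rank1Residual.Additive.PerrinRiouUnit

end
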